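import Summits.Ventures.GridStability.Models.InverterPLLClosedLoop
import Summits.Ventures.GridStability.Models.AggregateFrequency

/-!
# GridStability/Models/InverterPLLFaultDrift — the composed SRF-PLL closed loop during a bolted fault at the bus (`V_e = 0`): EXACT exponential / linear frequency drift

Cell `gridfusion` (LADDER-GRIDFUSION, apex-line rung G3.d, memo §3 GFM/GFL contrast under faults; seat
gridfusion-model-3 (g9); models/MODEL-3-NOTES.md §1 (P24)). Companion of
`Models/InverterDroopFirstOrderCCT.lean` (grid-FORMING first-order droop: during a bolted fault the angle
drifts LINEARLY, `δ = δ₀ + k_i p* t` (Qoria (V-26)), and the clearing-time dichotomy is exact).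

OBJECT: the COMPOSED grid-following closed loop of `Models/InverterPLLClosedLoop.lean` (p523722):
type-2 SRF-PLL AS PRINTED [cite: HenriquezAuba2022, eqs. (2.61a)–(2.61c)] closed through the printed
quasi-static q-axis relation [cite: Qoria2020, eq. (II-20)] `v_q = −V_e sin θ + R_g i_q + ω_g L_g i_d`
with constant current references and `ω_g := ω_pll` (loop factor `μ = 1 − k^p L_g i_d`). A three-phase
bolted fault at the infinite bus is READ as `V_e = 0` in that record (the branch `R_g, L_g` and the
injected currents `i_d, i_q` stay): the PCC q-voltage no longer sees the angle, `v_q = (R_g i_q +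
L_g i_d (ω* + k^i ε))/μ`, and by `hasDerivAt_freqMismatch` the mismatch `x = ω_pll − ω_s` obeys the
LINEAR law `μ ẋ = k^i (R_g i_q + ω_s L_g i_d) + k^i L_g i_d x` along every closed-loop solution.

WHAT IS CERTIFIED (kernel, closed form, 0 kit):
* `freqMismatch_fault_deriv` — the linear law above (V_e = 0 instance of `hasDerivAt_freqMismatch`).
* ACTIVE-CURRENT INJECTION (`L_g i_d ≠ 0`, `μ ≠ 0`): with `x∞ := −(R_g i_q + ω_s L_g i_d)/(L_g i_d)`
  and `r := k^i L_g i_d/μ`, EXACTLY `x(t) − x∞ = (x(0) − x∞) e^{r t}` on `[0, ∞)`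
  (`freqMismatch_fault_eq`); for `r > 0` (e.g. `i_d > 0`, `k^i, L_g > 0`, `μ > 0` — the anti-damping sign of
  the dictionary `dimD_pos_iff`) every solution with `x(0) ≠ x∞` has `|x(t) − x∞| → ∞`
  (`freqMismatch_fault_unbounded`): the PLL frequency runs away exponentially during the fault.
* PURE REACTIVE INJECTION (`i_d = 0`): `μ = 1` and EXACTLY `x(t) = x(0) + k^i R_g i_q · t` for every
  `t` (`freqMismatch_fault_eq_of_igd_zero`) — a linear frequency ramp unless `R_g i_q = 0`.
So in the MODEL a grid-following unit has no voltage to lock to during a close-in bolted fault and its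
post-fault state (frequency AND angle, `θ̇ = Ω_b x`) depends exponentially (resp. quadratically) on the
fault duration — in contrast with the grid-forming first-order droop model, whose fault-on drift is the
bounded-rate line (V-26) and whose clearing-time dichotomy is exact (#106-cand).

THREE COLUMNS. CERTIFIED: the identities above about the typed closed loop with `V_e = 0`. MODELLED +
COMPOSED: everything of `InverterPLLClosedLoop` (MV-INV-3, MV-6P: algebraic current loops with CONSTANT
references during the fault, quasi-static branch, no PLL filter / limiter / freeze, `ω_g := ω_pll`) + the
fault reading `V_e = 0` (the cell's scenario, not a printed case; the LVRT current-priority / PLL-freezing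
logic real converters apply is precisely what is absent). VALIDATED: nothing juxtaposed (printed analyses
of PLL behaviour under low-voltage current injection are not held; no parameter values — model-4 custody).
No sentence here says a converter or a grid is stable or unstable.
-/

noncomputable section

open Real Set Filter Topology

namespace Summit.Ventures.GridStability.Models.InverterPLL

namespace SrfPll

variable (L : SrfPll) (B : PccBranch)

/-- The branch record seen during a three-phase bolted fault at the infinite bus: `V_e := 0`, branch and
current references unchanged (the cell's fault READING of the composed closure). -/
def faulted (B : PccBranch) : PccBranch := { B with Ve := 0 }

/-- Field read-back: `V_e = 0` in the faulted record. -/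
@[simp] theorem faulted_Ve : (faulted B).Ve = 0 := rfl
/-- Field read-back. -/
@[simp] theorem faulted_Rg : (faulted B).Rg = B.Rg := rfl
/-- Field read-back. -/
@[simp] theorem faulted_Lg : (faulted B).Lg = B.Lg := rfl
/-- Field read-back. -/
@[simp] theorem faulted_igd : (faulted B).igd = B.igd := rfl
/-- Field read-back. -/
@[simp] theorem faulted_igq : (faulted B).igq = B.igq := rfl

/-- The loop factor does not see `V_e`: `μ(faulted) = μ`. -/
theorem loopFactor_faulted : L.loopFactor (faulted B) = L.loopFactor B := rfl

/-- Drift rate `r = k^i L_g i_d / μ` of the faulted loop. -/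
def faultRate : ℝ := L.ki * B.Lg * B.igd / L.loopFactor B

/-- The (unstable) rest mismatch of the faulted loop, `x∞ = −(R_g i_q + ω_s L_g i_d)/(L_g i_d)`. -/
def faultRest : ℝ := -(B.Rg * B.igq + L.ωs * B.Lg * B.igd) / (B.Lg * B.igd)

variable {L B}

/-- **The faulted closed loop is linear.** Along every closed-loop solution of the faulted record,
`ẋ = (k^i (R_g i_q + ω_s L_g i_d) + k^i L_g i_d · x)/μ` (the `V_e = 0` case of
`hasDerivAt_freqMismatch`: no restoring term, no `cos θ`-damping, only the constant anti-damping). -/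
theorem freqMismatch_fault_deriv (hμ : L.loopFactor B ≠ 0) {θ ε : ℝ → ℝ}
    (h : L.IsClosedLoopSolution (faulted B) θ ε) (t : ℝ) :
    HasDerivAt (fun τ => L.freqMismatch (faulted B) (θ τ) (ε τ))
      ((L.ki * (B.Rg * B.igq + L.ωs * B.Lg * B.igd)
        + L.ki * B.Lg * B.igd * L.freqMismatch (faulted B) (θ t) (ε t)) / L.loopFactor B) t := by
  have h1 := L.hasDerivAt_freqMismatch (faulted B) (by rw [loopFactor_faulted]; exact hμ) h t
  rw [loopFactor_faulted] at h1
  simp only [faulted_Ve, faulted_Rg, faulted_Lg, faulted_igd, faulted_igq, mul_zero, zero_mul,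
    sub_zero] at h1
  convert h1 using 2
  ring

/-- **Active-current injection: EXACT exponential law.** `L_g i_d ≠ 0`, `μ ≠ 0`: along every closed-loop
solution of the faulted record, for all `t ≥ 0`,
`x(t) − x∞ = (x(0) − x∞) · e^{r t}`, `r = k^i L_g i_d/μ`, `x∞ = −(R_g i_q + ω_s L_g i_d)/(L_g i_d)`. -/
theorem freqMismatch_fault_eq (hμ : L.loopFactor B ≠ 0) (hLi : B.Lg * B.igd ≠ 0) {θ ε : ℝ → ℝ}
    (h : L.IsClosedLoopSolution (faulted B) θ ε) {t : ℝ} (ht : 0 ≤ t) :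
    L.freqMismatch (faulted B) (θ t) (ε t) - L.faultRest B
      = (L.freqMismatch (faulted B) (θ 0) (ε 0) - L.faultRest B) * exp (L.faultRate B * t) := by
  set x : ℝ → ℝ := fun τ => L.freqMismatch (faulted B) (θ τ) (ε τ) with hx
  -- the linear law in the form `x' = (−r) (x∞ − x)`
  have hder : ∀ s ∈ Icc 0 t, HasDerivWithinAt x (-L.faultRate B * (L.faultRest B - x s)) (Icc 0 t) s := by
    intro s _
    have hL : B.Lg ≠ 0 := left_ne_zero_of_mul hLi
    have hi : B.igd ≠ 0 := right_ne_zero_of_mul hLi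
    refine ((freqMismatch_fault_deriv hμ h s).hasDerivWithinAt).congr_deriv ?_
    simp only [faultRate, faultRest, hx]
    field_simp
    ring
  have := AggregateFrequency.sub_eq_mul_exp hder ⟨ht, le_rfl⟩
  simpa [neg_mul, neg_neg] using this

/-- **Exponential runaway.** If moreover `r = k^i L_g i_d/μ > 0` and the initial mismatch is not exactly
`x∞`, then `|x(t) − x∞| → ∞`: during the fault the PLL frequency of the MODEL leaves every band. -/
theorem freqMismatch_fault_unbounded (hμ : L.loopFactor B ≠ 0) (hLi : B.Lg * B.igd ≠ 0)
    (hr : 0 < L.faultRate B) {θ ε : ℝ → ℝ} (h : L.IsClosedLoopSolution (faulted B) θ ε)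
    (h0 : L.freqMismatch (faulted B) (θ 0) (ε 0) ≠ L.faultRest B) :
    Tendsto (fun t => |L.freqMismatch (faulted B) (θ t) (ε t) - L.faultRest B|) atTop atTop := by
  have hlim : Tendsto (fun t => |L.freqMismatch (faulted B) (θ 0) (ε 0) - L.faultRest B|
      * exp (L.faultRate B * t)) atTop atTop :=
    (tendsto_exp_atTop.comp (tendsto_id.const_mul_atTop hr)).const_mul_atTop (abs_pos.2 (sub_ne_zero.2 h0))
  refine hlim.congr' ?_
  filter_upwards [eventually_ge_atTop (0:ℝ)] with t ht
  rw [freqMismatch_fault_eq hμ hLi h ht, abs_mul, abs_of_pos (exp_pos _)]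

/-- **Pure reactive injection (`i_d = 0`): EXACT linear ramp.** `μ = 1` and along every closed-loop
solution of the faulted record `x(t) = x(0) + k^i R_g i_q · t` for EVERY `t` — the frequency of the
MODEL ramps at the constant rate `k^i R_g i_q` unless `R_g i_q = 0`. -/
theorem freqMismatch_fault_eq_of_igd_zero (hid : B.igd = 0) {θ ε : ℝ → ℝ}
    (h : L.IsClosedLoopSolution (faulted B) θ ε) (t : ℝ) :
    L.freqMismatch (faulted B) (θ t) (ε t)
      = L.freqMismatch (faulted B) (θ 0) (ε 0) + L.ki * B.Rg * B.igq * t := by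
  have hμ1 : L.loopFactor B = 1 := by simp [loopFactor, hid]
  set x : ℝ → ℝ := fun τ => L.freqMismatch (faulted B) (θ τ) (ε τ) with hx
  have hder : ∀ s, HasDerivAt x (L.ki * B.Rg * B.igq) s := by
    intro s
    refine (freqMismatch_fault_deriv (by rw [hμ1]; exact one_ne_zero) h s).congr_deriv ?_
    simp [hid, hμ1]; ring
  -- a function with constant derivative is affine
  have hg : ∀ s, HasDerivAt (fun τ => x τ - L.ki * B.Rg * B.igq * τ) 0 s := by
    intro s
    have h2 := (hder s).sub ((hasDerivAt_id s).const_mul (L.ki * B.Rg * B.igq))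
    rw [mul_one, sub_self] at h2
    exact h2
  have hconst := is_const_of_deriv_eq_zero (fun s => (hg s).differentiableAt)
    (fun s => (hg s).deriv) t 0
  simp only [mul_zero, sub_zero] at hconst
  show x t = x 0 + L.ki * B.Rg * B.igq * t
  linarith

/-- The angle follows the mismatch: `θ̇ = Ω_b x` also for the faulted record (for the record). -/
theorem hasDerivAt_angle_fault {θ ε : ℝ → ℝ} (h : L.IsClosedLoopSolution (faulted B) θ ε) (t : ℝ) :
    HasDerivAt θ (L.Ωb * L.freqMismatch (faulted B) (θ t) (ε t)) t :=
  L.hasDerivAt_angle (faulted B) h t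

/-- Sign of the drift rate: for `μ > 0`, `r > 0 ⟺ k^i L_g i_d > 0` (the anti-damping sign of the
dictionary, `dimD_pos_iff`): active current INTO an inductive branch with positive integral gain. -/
theorem faultRate_pos_iff (hμ : 0 < L.loopFactor B) : 0 < L.faultRate B ↔ 0 < L.ki * B.Lg * B.igd := by
  unfold faultRate
  rw [div_pos_iff_of_pos_right hμ]

end SrfPll

end Summit.Ventures.GridStability.Models.InverterPLL

end
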